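import Summits.QuantumFields.BalabanUV.T4Continuum.Support.NE7ApeTrivialFlatEndDischarged
import Summits.QuantumFields.BalabanUV.T4Continuum.Support.NE7GradientCurrencyCovariant
import HarnessLib

/-!
# T⁴ programme, row NE7 — (159) THE END AT THE TRIVIAL FLAT DATUM WITH THE GRADIENT CURRENCY DERIVED: `smallField_of_trivialLetters_final`
# re-issued with REP♭'s gradient hypothesis `‖∇A₀‖ ≤ a₁` REPLACED by the covariant flux-divergence bound on `U` ([Balaban1985RegularSpaces] (1.2),
# `B8Ineq132.covDiv`) and the Landau reaction gradient of `A₀` (`NE7ApeTrivialFlatEndGradient`)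

Cell `pub-balaban`, rung (B)+1 sub-cell t4, row NE7.  Lineage `b2b-balaban-t4-ne7-p2` (CRUX PROVER NE7 #2 = co-owner of row NE7),
generation 88; last file of the chain (156)–(159) «THE GRADIENT CURRENCY `a₁` OF REP♭ IS NOT AN INDEPENDENT LETTER», over (155)
`NE7ApeTrivialFlatEndDischarged.smallField_of_trivialLetters_final` (this lineage gen 87, re-landed by the OWNER t4-ne7-p1 gen 72) and (158)
`NE7GradientCurrencyCovariant.gradient_currency_of_covDiv`.

WHY.  After (155) THE END asks of B8's output over the fibre point `U` (`cavgIter L (k+1) U = 1`): a unitary periodic gauge `u₀`, a periodic `A₀`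
with `U^{u₀} = e^{A₀}`, and TWO currencies — the sup `‖A₀‖ ≤ a₀` and the gradient `‖∇A₀‖ ≤ a₁` ([Balaban1985RegularSpaces] Thm 2 (1.36) TYPE).
(156)–(158) prove the gradient currency FROM the sup currency, the covariant flux divergence `sup‖(D*_U ∂U)‖ ≤ j` of `U` ITSELF ((1.2)∕(1.9) TYPE;
gauge-invariant; at the fibre point it is what tangent-criticality controls — the OWNER's R1 `NE7CriticalFirstVariation` + the by-parts dictionary R2)
and the Landau reaction gradient `‖∇ div A₀‖ ≤ r` of the representative ((1.38)∕(1.39) TYPE; `r = 0` in an exact lattice Landau gauge), in THE END's own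
regime: the displayed lines `ω ≥ M(e^{a₀} − 1) + …`, `300(d+1)ω ≤ 1` already force `a₀ ≤ 1∕64` and `128(d+1)·M·a₀ ≤ 1`.  So:

* `covDiv_add_period` — (1.2) of a periodic configuration is periodic (service lemma for (160)); `covDiv_flat_eq_zero` — (1.2) vanishes at `U = 1` (non-vacuity of `hcov`).
* **`smallField_of_trivialLetters_gradient`** — (155)'s `smallField_of_trivialLetters_final`, SAME conclusion, SAME other binders, with `ha₁ : ‖∇A₀‖ ≤ a₁`
  REPLACED by `hcov : ‖covDiv 1 U ν x‖ ≤ j`, `hdiv : ‖div A₀(x+e_ν) − div A₀(x)‖ ≤ r` and the numeric line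
  `ha₁' : 4·((d+1)·a₀∕M + M·(j + (d+1)·(δ∕M²)·((e^{2a₀} − 1) + 2(δ∕M²)(2 + δ∕M²)) + r)) ≤ a₁` (`M = L^{k+1}`).

NET EFFECT ON THE (APE)-BILL AT THE TRIVIAL FLAT DATUM: of the representative THE END now asks `u₀` unitary periodic, `U^{u₀} = e^{A₀}`, `A₀` periodic,
the SUP currency `a₀` and the Landau reaction `r` — what a Landau-type gauge construction delivers — plus the (1.9)-type regularity `j` of the OBJECT `U`;
the gradient currency is no longer posited.  HONEST FRAMING (page 1): composition BY NAME; `(u₀, A₀, a₀, r)`, `j` and `hcritU` remain HYPOTHESES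
([Balaban1985RegularSpaces] Thm 2 (1.36)₁∕(1.38)–(1.39) TYPE ∕ (1.9) TYPE ∕ the object's definition); numeric lines displayed; constants not optimised;
ONE datum; (APE) NOT proved unconditionally; NOT NE7; NE7 NOT PRINTED ∕ NOT PROVED; spine 0∕9; FIXED FINITE T⁴, rung (B)+1 — NOT infinite volume, NOT
mass gap, NOT Clay.  Continuum YM on T⁴ ⇐ BetaPertH ∧ nine spine estimates (0/9 proved); BetaPertH ⇐ (D1) ∧ (D4) ∧ CAP+tail; G-an2-4 gates asym,
D1 and NE2/3/4.  No `sorry`.  PLACEMENT: our lemma, under `Summits/QuantumFields/BalabanUV/`.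
-/

set_option autoImplicit false

open scoped BigOperators Matrix.Norms.L2Operator
open NormedSpace Finset

namespace Summit.QuantumFields.BalabanUV.T4Continuum.NE7ApeTrivialFlatEndGradient

open Literature.MathematicalPhysics.QuantumFieldTheory.Balaban1983to89
open B7Prop1Explicit B7Prop2Explicit MatrixLog UnitaryModel
open B8Ineq132 (covDiv)
open T4AveragingDeficitWall (IsUnitaryCfg IsSkewDir SmallField vary curlAt dirL1)
open T4AveragingDeficitWallBoundary (IsPeriodicCfg periodBox)
open T4AveragingDeficitNonAbelian (hol_add_period)
open AveragingDeficitPeriodicCounting (IsPeriodicDir)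
open AveragingDeficitMultiLevelPrep (cavgIter LevelSmall)
open MinimalActionLevels (perWin)
open BlockAveragePushDirSplit (flat)
open BlockAverageVaryHolo (nbRad)
open BlockAverageVaryDisc (rho0)
open B4Sect5Proof (latticeConst)
open B5Hk163Strip (kappa163)
open B5Hk163TorusHolderDecay (CdecD)
open NE3HessForm (hess dAction)
open NE3TangentCovariantTower (dirIter)
open NE3QbarIterCovLiftPrep (cruxC)
open NE3RightInverseSolveLetters (thetaLoc)
open NE3HatInvCurlLetters (curl1C)
open NE3EnergyShapes (IsUnitarySite)
open NE7ApeTrivialFlatEndDischarged (smallField_of_trivialLetters_final)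
open NE7GradientCurrencyCovariant (gradient_currency_of_covDiv)

noncomputable section

variable {d : ℕ}

/-- Service lemma for the composition (160) (the OWNER's R4 `NE7CovDivB8Letter.norm_covDiv_le_of_tanCritical` bounds (1.2) on the period box):
for a `P`-periodic configuration the covariant divergence (1.2) is `P`-periodic, so a bound on `periodBox` is a bound everywhere. [folklore] -/
theorem covDiv_add_period {n : Type} [Fintype n] [DecidableEq n] {U : Site d → Fin d → (Matrix n n ℂ)ˣ} {P : ℤ}
    (hUP : IsPeriodicCfg U P) (η : ℝ) (ν : Fin d) (y : Site d) (i : Fin d) :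
    covDiv η U ν (y + P • e i) = covDiv η U ν y := by
  unfold covDiv B8Ineq132.covDeriv B8Ineq132.plaqF
  have h1 : ∀ μ : Fin d, y + P • e i - e μ = (y - e μ) + P • e i := fun μ => by abel
  have hU' : ∀ (x : Site d) (μ : Fin d), U (x + P • e i) μ = U x μ := fun x μ => hUP x i μ
  simp only [h1, hol_add_period hUP, hU']

/-- Non-vacuity service lemma (the desk's E-62-1-class test for the new binder `hcov`): at the flat configuration the covariant divergence (1.2)
vanishes identically, so `hcov` holds at the witness `U = 1` of the OWNER's W1 `NE7ApeTrivialFlatEndWitness` with `j = 0`. [folklore] -/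
theorem covDiv_flat_eq_zero {n : Type} [Fintype n] [DecidableEq n] (η : ℝ) (ν : Fin d) (y : Site d) :
    covDiv η (flat (d := d) (n := n)) ν y = 0 := by
  unfold covDiv B8Ineq132.covDeriv B8Ineq132.plaqF
  simp [B7Eq78Linearization.conjR_apply, BlockAveragePushDirSplit.flat, T4AveragingDeficitWall.hol_flat]

/-- **THE END's REGIME ALREADY CONTAINS THE GRADIENT LETTER's REGIME**: from `M(e^{a₀} − 1) + (nonnegative) ≤ ω` and `300(d+1)ω ≤ 1`:
`a₀ ≤ 1∕64` and `128(d+1)·M·a₀ ≤ 1` (`a₀ ≤ e^{a₀} − 1`, `M ≥ 1`, `d + 1 ≥ 1`). [folklore] -/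
theorem regime_of_omega_lines {M a₀ ω D c : ℝ} (hM : 1 ≤ M) (hD : 1 ≤ D) (hc : 0 ≤ c)
    (hω' : M * (Real.exp a₀ - 1) + c ≤ ω) (hωd : 300 * D * ω ≤ 1) :
    a₀ ≤ 1 / 64 ∧ 128 * D * M * a₀ ≤ 1 := by
  have h1 : a₀ ≤ Real.exp a₀ - 1 := by have := Real.add_one_le_exp a₀; linarith
  have hω : ω ≤ 1 / 300 := by
    rcases le_or_gt 0 ω with h | h
    · have : 300 * ω ≤ 300 * D * ω := by nlinarith
      linarith
    · linarith
  have hMω : M * (Real.exp a₀ - 1) ≤ ω := by linarith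
  rcases le_or_gt a₀ 0 with ha | ha
  · refine ⟨by linarith, ?_⟩
    have : 128 * D * M * a₀ ≤ 0 := by
      have hDM : 0 ≤ 128 * D * M := by positivity
      exact mul_nonpos_of_nonneg_of_nonpos hDM ha
    linarith
  · have he : 0 < Real.exp a₀ - 1 := by linarith
    have hMa : M * a₀ ≤ ω := by nlinarith
    have ha1 : a₀ ≤ ω := by nlinarith
    refine ⟨by linarith, ?_⟩
    have hDω : D * ω ≤ 1 / 300 := by nlinarith
    have : D * (M * a₀) ≤ D * ω := mul_le_mul_of_nonneg_left hMa (by linarith)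
    nlinarith

/-- **THE END AT THE TRIVIAL FLAT DATUM WITH THE GRADIENT CURRENCY DERIVED.**  (155)'s `smallField_of_trivialLetters_final` — every binder and the
conclusion VERBATIM — except that the gradient hypothesis `ha₁ : ‖A₀(y+e_τ)_κ − A₀(y)_κ‖ ≤ a₁` on B8's representative is REPLACED by:
`hcov : ‖covDiv 1 U ν x‖ ≤ j` (the covariant flux divergence [Balaban1985RegularSpaces] (1.2) of the OBJECT `U`, gauge-invariant — (1.9) TYPE),
`hdiv : ‖div A₀(x+e_ν) − div A₀(x)‖ ≤ r` (the Landau reaction gradient of the representative — (1.38)∕(1.39) TYPE; `0` in an exact Landau gauge), and the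
numeric line `ha₁' : 4((d+1)a₀∕M + M(j + (d+1)(δ∕M²)((e^{2a₀}−1) + 2(δ∕M²)(2+δ∕M²)) + r)) ≤ a₁` — by (158) `gradient_currency_of_covDiv` at radius
`R = M = L^{k+1}`, in the regime `a₀ ≤ 1∕64`, `128(d+1)Ma₀ ≤ 1` that the displayed `ω`-lines already force (`regime_of_omega_lines`). [folklore] -/
theorem smallField_of_trivialLetters_gradient {n : Type} [Fintype n] [DecidableEq n] [Nonempty n] (hd : 1 ≤ d) {L : ℕ} (hL : 2 ≤ L) :
    ∃ K : ℝ, 0 ≤ K ∧ ∀ (N : ℕ) [NeZero N] (k : ℕ)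
    {U : Site (d + 1) → Fin (d + 1) → (Matrix n n ℂ)ˣ} (hU : IsUnitaryCfg U) {x δ : ℝ} (hx : 0 ≤ x) (hs : LevelSmall (d + 1) L k x)
    (hUx : SmallField U x) (hδ : 0 ≤ δ) (hUδ : SmallField U (δ / ((L : ℝ) ^ (k + 1)) ^ 2)) (hδx : δ / ((L : ℝ) ^ (k + 1)) ^ 2 ≤ x)
    (hcritU : ∀ φ : Site (d + 1) → Fin (d + 1) → Matrix n n ℂ, IsSkewDir φ → IsPeriodicDir φ ((L ^ (k + 1) * N : ℕ) : ℤ) →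
      dirIter L (k + 1) U φ = 0 → dAction U φ (perWin (d + 1) (L ^ (k + 1) * N)) = 0)
    (hflatTopU : cavgIter L (k + 1) U = flat)
    {j : ℝ} (hcov : ∀ (ν : Fin (d + 1)) (y : Site (d + 1)), ‖covDiv 1 U ν y‖ ≤ j)
    {u₀ : Site (d + 1) → (Matrix n n ℂ)ˣ} (hu₀ : IsUnitarySite u₀)
    (hu₀P : ∀ (y : Site (d + 1)) (i : Fin (d + 1)), u₀ (y + (((L ^ (k + 1) * N : ℕ) : ℤ)) • e i) = u₀ y)
    {A₀ : Site (d + 1) → Fin (d + 1) → Matrix n n ℂ} (hgauge₀ : gaugeAct u₀ U = vary (flat (d := d + 1) (n := n)) A₀ 1)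
    (hA₀P : IsPeriodicDir A₀ ((L ^ (k + 1) * N : ℕ) : ℤ))
    {a₀ a₁ r ω : ℝ} (ha₀ : ∀ (y : Site (d + 1)) (κ : Fin (d + 1)), ‖A₀ y κ‖ ≤ a₀)
    (hdiv : ∀ (y : Site (d + 1)) (ν : Fin (d + 1)),
      ‖∑ μ, (A₀ (y + e ν) μ - A₀ (y + e ν - e μ) μ) - ∑ μ, (A₀ y μ - A₀ (y - e μ) μ)‖ ≤ r)
    (ha₁' : 4 * (((d + 1 : ℕ) : ℝ) * a₀ / (L : ℝ) ^ (k + 1) + (L : ℝ) ^ (k + 1) *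
        ((j + ((d + 1 : ℕ) : ℝ) * ((δ / ((L : ℝ) ^ (k + 1)) ^ 2) * ((Real.exp (2 * a₀) - 1)
            + 2 * (δ / ((L : ℝ) ^ (k + 1)) ^ 2) * (2 + δ / ((L : ℝ) ^ (k + 1)) ^ 2)))) + r)) ≤ a₁)
    (hω' : (L : ℝ) ^ (k + 1) * (Real.exp a₀ - 1)
        + 136 * ((((d + 1 : ℕ) : ℝ) + 1) * (((d + 1 : ℕ) : ℝ) + 4)) * (((L : ℝ) ^ (k + 1)) ^ 2 * (δ / ((L : ℝ) ^ (k + 1)) ^ 2)) ≤ ω)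
    (hωd : 300 * ((d + 1 : ℕ) : ℝ) * ω ≤ 1) (hβ : Real.exp a₀ - 1 + 8 * ω / (L : ℝ) ^ (k + 1) ≤ 1 / 4)
    {α₀ α₁ αh1 : ℝ} (hAα' : 2 * (Real.exp a₀ - 1 + 8 * ω / (L : ℝ) ^ (k + 1)) ≤ α₀)
    (hA1' : 4 / 3 * (Real.exp a₀ * a₁ + 2 * (8 * ω / (L : ℝ) ^ (k + 1)) * (Real.exp a₀ - 1)
        + 165 * ω / ((L : ℝ) ^ (k + 1)) ^ 2 + (8 * ω / (L : ℝ) ^ (k + 1)) ^ 2) ≤ α₁)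
    (hα₁h : α₁ ≤ αh1 / ((L : ℝ) ^ (k + 1)) ^ 2)
    (hθ : cruxC (d + 1) L * (((L : ℝ) ^ (k + 1)) ^ 2 * x) < 1) (hθl : thetaLoc (d + 1) L * (((L : ℝ) ^ (k + 1)) ^ 2 * x) < 1)
    (hε : ((L : ℝ) ^ (k + 1)) ^ 2 * x ≤ 1)
    (hσ : 4 * (3 + 12 * ((d + 1 : ℕ) : ℝ)) ^ 2 * (L : ℝ) ^ (k + 1) * α₀ ≤ rho0 (d + 1) L ^ 2)
    (hS1 : (8 * (3 + 12 * ((d + 1 : ℕ) : ℝ)) * (2 + 2 * ((((d + 1 : ℕ) : ℝ) + 1) * L)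
        * (1 + ((1250 * ((nbRad (d + 1) L : ℝ) + L) + 8 * (((d + 1 : ℕ) : ℝ) * L) + 2 * L) * (((d + 1 : ℕ) : ℝ) * (2 * nbRad (d + 1) L + 1) ^ (d + 1)))
            / ((L : ℝ) / (L : ℝ) ^ (d + 1))))) * ((L : ℝ) ^ (k + 1) * α₀) ≤ 1)
    (hb : 256 * (((d + 1 : ℕ) : ℝ) + 1) * L * (3 + 12 * ((d + 1 : ℕ) : ℝ)) * ((L : ℝ) ^ (k + 1) * α₀) ≤ 1),
    SmallField U
      ((K * (2 * (curl1C (d + 1) L / (1 - thetaLoc (d + 1) L * (((L : ℝ) ^ (k + 1)) ^ 2 * x)))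
                * (8 * (3 + 12 * ((d + 1 : ℕ) : ℝ)) * (2 + 2 * ((((d + 1 : ℕ) : ℝ) + 1) * L)
                  * (1 + ((1250 * ((nbRad (d + 1) L : ℝ) + L) + 8 * (((d + 1 : ℕ) : ℝ) * L) + 2 * L)
                      * (((d + 1 : ℕ) : ℝ) * (2 * nbRad (d + 1) L + 1) ^ (d + 1))) / ((L : ℝ) / (L : ℝ) ^ (d + 1)))))
                * δ * ((L : ℝ) ^ (k + 1) * α₀)
              + (Fintype.card (T4AveragingDeficitWall.Plane (d + 1)) : ℝ)
                * (144 * (((L : ℝ) ^ (k + 1) * α₀) * αh1) + 5440 * ((L : ℝ) ^ (k + 1) * α₀) ^ 3 + 8 * (αh1 * αh1)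
                    + 304 * (αh1 * ((L : ℝ) ^ (k + 1) * α₀) ^ 2) + 2688 * ((L : ℝ) ^ (k + 1) * α₀) ^ 4))
          + Fintype.card n * (2 * (CdecD d * (((d : ℝ) + 1) * (2 * ((d : ℝ) + 1))
              * ((2 + 32 / (kappa163 (d + 1) / (d + 1)) ^ 2) * latticeConst (d + 1) (kappa163 (d + 1) / (d + 1) / 2)))))
            * (0 + 28 * ((3 + 12 * ((d + 1 : ℕ) : ℝ)) * ((L : ℝ) ^ (k + 1) * α₀)
                  + 4 * (3 + 12 * ((d + 1 : ℕ) : ℝ)) ^ 3 / rho0 (d + 1) L ^ 2 * ((L : ℝ) ^ (k + 1) * α₀) ^ 2) ^ 2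
                + 4 * (4 * (3 + 12 * ((d + 1 : ℕ) : ℝ)) ^ 3 / rho0 (d + 1) L ^ 2 * ((L : ℝ) ^ (k + 1) * α₀) ^ 2))
          + 28 * ((L : ℝ) ^ (k + 1) * α₀) ^ 2)
        / ((L : ℝ) ^ (k + 1)) ^ 2) := by
  obtain ⟨K, hK, h⟩ := smallField_of_trivialLetters_final (n := n) hd hL
  refine ⟨K, hK, ?_⟩
  intro N _ k U hU x δ hx hs hUx hδ hUδ hδx hcritU hflatTopU j hcov u₀ hu₀ hu₀P A₀ hgauge₀ hA₀P a₀ a₁ r ω ha₀ hdiv ha₁' hω' hωd hβ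
    α₀ α₁ αh1 hAα' hA1' hα₁h hθ hθl hε hσ hS1 hb
  -- the regime
  have hL1 : (1 : ℝ) ≤ (L : ℝ) := by exact_mod_cast (le_trans (by norm_num) hL : 1 ≤ L)
  have hM1 : (1 : ℝ) ≤ (L : ℝ) ^ (k + 1) := one_le_pow₀ hL1
  have hD1 : (1 : ℝ) ≤ ((d + 1 : ℕ) : ℝ) := by exact_mod_cast Nat.succ_le_succ (Nat.zero_le d)
  have hc0 : 0 ≤ 136 * ((((d + 1 : ℕ) : ℝ) + 1) * (((d + 1 : ℕ) : ℝ) + 4)) * (((L : ℝ) ^ (k + 1)) ^ 2 * (δ / ((L : ℝ) ^ (k + 1)) ^ 2)) := by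
    positivity
  obtain ⟨ha₀s, hreg⟩ := regime_of_omega_lines hM1 hD1 hc0 hω' hωd
  -- the gradient currency from (158) at `R = M`
  have hMnat : 1 ≤ L ^ (k + 1) := Nat.one_le_pow _ _ (by omega)
  have hPer : 1 ≤ L ^ (k + 1) * N := Nat.mul_pos hMnat (Nat.pos_of_ne_zero (NeZero.ne N))
  have hMcast : ((L ^ (k + 1) : ℕ) : ℝ) = (L : ℝ) ^ (k + 1) := by push_cast; ring
  have hε0 : 0 ≤ δ / ((L : ℝ) ^ (k + 1)) ^ 2 := by positivity
  have hreg' : 128 * ((d + 1 : ℕ) : ℝ) * ((L ^ (k + 1) : ℕ) : ℝ) * a₀ ≤ 1 := by rw [hMcast]; exact hreg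
  have ha₁ : ∀ (y : Site (d + 1)) (κ τ : Fin (d + 1)), ‖A₀ (y + e τ) κ - A₀ y κ‖ ≤ a₁ := by
    intro y κ τ
    have h1 := gradient_currency_of_covDiv (d := d + 1) (by omega) hε0 hUδ hcov hu₀ hgauge₀ hPer hA₀P ha₀ ha₀s hdiv hMnat hreg' y κ τ
    rw [hMcast] at h1
    exact h1.trans ha₁'
  exact h N k hU hx hs hUx hδ hUδ hδx hcritU hflatTopU hu₀ hu₀P hgauge₀ hA₀P ha₀ ha₁ hω' hωd hβ hAα' hA1' hα₁h hθ hθl hε hσ hS1 hb
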